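import Literature.AnabelianGeometry.EtaleTheta.SettingModelBTorsionTowerTransport
import HarnessLib

/-!
# COROLLARY R1′ from (PBF): `θ`-stable `b`-lines are axis lines (ROUTE-PBF file T2)

PROOF-ONLY.  `torusStable_of_permBasisFixedPoints`.
Classical profinite group theory about OUR semi-synthetic `F₂hatT`; CONDITIONAL (where stated) on the displayed
tree-free hypothesis `PermBasisFixedPoints`; nothing about [EtTh]/[IUTchII]/[IUTchIII] in print; no side on
[IUTchIII] Cor 3.12; nothing here asserts abc proved or refuted.  abc-iut-L6-t19 gen 22 (ROUTE-PBF, rung (L3′) slice 1).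
-/

noncomputable section

namespace Literature.AnabelianGeometry.EtaleTheta.SettingModel.BTorsionTower

open Literature.AnabelianGeometry.EtaleTheta.SettingModel
open Literature.AnabelianGeometry.EtaleTheta (ZHatLevel.level ZHatLevel.levelChar)
open Literature.AnabelianGeometry.SemiGraphs
open Literature.AnabelianGeometry.AbsoluteAnabelian
open Literature.IUT.HodgeTheaters (profiniteCompletion toCompletion)
open CategoryTheory
open Literature.AnabelianGeometry.EtaleTheta.SettingModel.TreeFree (permHat PermBasisFixedPoints permHat_toCompletion)

section StableLines

variable (p : ℕ) [Fact p.Prime]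

/-- **COROLLARY R1′ of PL3-R1A, from (PBF) alone**: if `x⁻¹ θ_{χ(σ)}(x) ∈ b^Ẑ` for every `σ ∈ G_{ℚ_p}` (the
`b`-line `x b^Ẑ x⁻¹` is stable under the torus), then `x = a^s b^t`.  Same tower; the `C_n`-component of
`φ_n(x)` is unconstrained and becomes `b^t`. [cite: MochizukiEtTh2009, §1 p.12] -/
theorem torusStable_of_permBasisFixedPoints (hPBF : PermBasisFixedPoints.{0})
    (U : Subgroup (GQp p)) [U.FiniteIndex] (x : F₂hatT)
    (hx : ∀ σ ∈ U, x⁻¹ * twist (chi p σ) x ∈ bAxis) :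
    ∃ s t : ZH, x = powHat (eta (FreeGroup.of 0)) s * bPow t := by
  classical
  -- Cantor intersection over the level kernels, family `F (s,t) = a^s b^t` on the compact `Ẑ × Ẑ`
  let F : ZH × ZH → F₂hatT := fun st => powHat (eta (FreeGroup.of 0)) st.1 * bPow st.2
  have hF : Continuous F := ((powHat _).continuous.comp continuous_fst).mul (bPow.continuous.comp continuous_snd)
  suffices h : ∃ st : ZH × ZH, x = F st by
    obtain ⟨⟨s, t⟩, hst⟩ := h
    exact ⟨s, t, hst⟩
  haveI : Nonempty (FiniteIndexNormalSubgroup F₂) := ⟨⊤, inferInstance, inferInstance⟩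
  refine exists_eq_of_levelwise_mem (fun M : FiniteIndexNormalSubgroup F₂ => (levelMap M).toMonoidHom.ker)
    (fun M => ?_) (fun M₁ M₂ => ⟨M₁ ⊓ M₂, ?_, ?_⟩) (fun y hy => ?_) hF x (fun M => ?_)
  · haveI : DiscreteTopology ((ProfiniteGrp.ProfiniteCompletion.diagram (GrpCat.of F₂)).obj M) := ⟨rfl⟩
    exact (isOpen_discrete ({1} : Set _)).preimage (levelMap M).continuous
  · intro y (hy : (levelMap (M₁ ⊓ M₂)) y = 1)
    change levelMap M₁ y = 1
    change y.val M₁ = 1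
    have h := Literature.IUT.HodgeTheaters.ProfiniteCompletion.val_mk_eq_of_le y
      (inf_le_left : M₁ ⊓ M₂ ≤ M₁) 1 (by rw [QuotientGroup.mk_one]; exact hy)
    rw [h]; rfl
  · intro y (hy : (levelMap (M₁ ⊓ M₂)) y = 1)
    change y.val M₂ = 1
    have h := Literature.IUT.HodgeTheaters.ProfiniteCompletion.val_mk_eq_of_le y
      (inf_le_right : M₁ ⊓ M₂ ≤ M₂) 1 (by rw [QuotientGroup.mk_one]; exact hy)
    rw [h]; rfl
  · exact Subtype.ext (funext fun M => by
      have h : y.val M = 1 := hy M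
      rw [h]; rfl)
  -- the level-`M` statement
  haveI : DiscreteTopology ((ProfiniteGrp.ProfiniteCompletion.diagram (GrpCat.of F₂)).obj M) := ⟨rfl⟩
  haveI : Finite ((ProfiniteGrp.ProfiniteCompletion.diagram (GrpCat.of F₂)).obj M) :=
    inferInstanceAs (Finite (F₂ ⧸ M.toSubgroup))
  let ψ := levelMap M
  set A := ψ (eta (FreeGroup.of 0)) with hA
  set B := ψ (eta (FreeGroup.of 1)) with hB
  let N : ℕ+ := ⟨orderOf B, orderOf_pos B⟩
  obtain ⟨n, hNn, had⟩ := exists_adapted p U N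
  have hψ : ψ (eta (FreeGroup.of 1)) ^ (n : ℕ) = 1 := by
    rw [← hB]; exact orderOf_dvd_iff_pow_eq_one.1 hNn
  have hBpow : ∀ i : ZMod n, (∀ σ ∈ U, ZHatLevel.levelChar n (chi p σ) * i = i) →
      rotPart n ψ hψ (Multiplicative.ofAdd i) = 1 := by
    intro i hi
    haveI : NeZero (n : ℕ) := ⟨n.ne_zero⟩
    have h := rotPart_ofAdd_intCast n ψ hψ (i.val : ℤ)
    rw [Int.cast_natCast, ZMod.natCast_zmod_val, zpow_natCast] at h
    rw [h, ← hB]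
    exact orderOf_dvd_iff_pow_eq_one.1 (dvd_val_of_fixed p U had hi)
  -- `q = φ_n x` and the stability read in `Q_n`
  set q := phi n x with hq
  have hqstab : ∀ σ : U, ∃ d : Multiplicative (ZMod n),
      q⁻¹ * affHat n (ZHatLevel.levelChar n (chi p (σ : GQp p))) 0 q = etaL n (SemidirectProduct.inr d) := by
    intro σ
    obtain ⟨t, ht⟩ := (mem_bAxis_iff _).1 (hx σ σ.2)
    refine ⟨ZHatLevel.level n t, ?_⟩
    rw [hq, ← phi_twist, ← phi_bPow, ht, map_mul, map_inv]
  -- decomposition `q = ν″ · η_Λ(inr c)` with `ν″ ∈ N̂`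
  haveI : (Glet n).FiniteIndex := finiteIndex_Glet n
  obtain ⟨f, hf⟩ := Literature.IUT.HodgeTheaters.ProfiniteCompletion.exists_inv_mul_mem_closure (Glet n) q
  set c := f.right with hc
  set ν'' := q * (etaL n (SemidirectProduct.inr c))⁻¹ with hν''
  have hν''mem : ν'' ∈ NhatSub n := by
    have hμ : (etaL n f)⁻¹ * q ∈ NhatSub n := by
      rw [← SetLike.mem_coe, coe_NhatSub]; exact hf
    have hf' : etaL n f = etaL n (SemidirectProduct.inl f.left) * etaL n (SemidirectProduct.inr c) := by
      rw [← map_mul, hc, SemidirectProduct.inl_left_mul_inr_right]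
    -- `ν'' = η(inl f.left) · [η(inr c) μ η(inr c)⁻¹]`
    have hconj : etaL n (SemidirectProduct.inr c) * ((etaL n f)⁻¹ * q) * (etaL n (SemidirectProduct.inr c))⁻¹
        ∈ NhatSub n := by
      have h := conj_inr_mem_NhatSub n c⁻¹ hμ
      simpa only [map_inv, inv_inv] using h
    have heq : ν'' = etaL n (SemidirectProduct.inl f.left) *
        (etaL n (SemidirectProduct.inr c) * ((etaL n f)⁻¹ * q) * (etaL n (SemidirectProduct.inr c))⁻¹) := by
      rw [hν'', hf']; group
    rw [heq]
    exact (NhatSub n).mul_mem (etaL_inl_mem_NhatSub n f.left) hconj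
  have hqdec : q = ν'' * etaL n (SemidirectProduct.inr c) := by rw [hν'']; group
  -- `ν″` is fixed by the `k̂`
  obtain ⟨π, hπη, hπN, hπaff⟩ := exists_projC n
  have hν''fix : ∀ σ ∈ U, affHat n (chiUnit p n σ) 0 ν'' = ν'' := by
    intro σ hσ
    obtain ⟨d, hd⟩ := hqstab ⟨σ, hσ⟩
    set u := ZHatLevel.levelChar n (chi p σ) with hu
    -- `ν″⁻¹ k̂(ν″) = η(inr (c · d · (u•c)⁻¹))`
    have h1 : ν''⁻¹ * affHat n u 0 ν'' =
        etaL n (SemidirectProduct.inr (c * d * (affRot n u c)⁻¹)) := by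
      have h2 : affHat n u 0 q = affHat n u 0 ν'' * etaL n (SemidirectProduct.inr (affRot n u c)) := by
        rw [hqdec, map_mul, affHat_etaL, aff_inr]
      have h3 : q⁻¹ * affHat n u 0 q = etaL n (SemidirectProduct.inr d) := hd
      rw [h2] at h3
      rw [hqdec] at h3
      -- solve for `ν″⁻¹ k̂(ν″)`
      have h4 : ν''⁻¹ * affHat n u 0 ν'' =
          etaL n (SemidirectProduct.inr c) * etaL n (SemidirectProduct.inr d) *
            (etaL n (SemidirectProduct.inr (affRot n u c)))⁻¹ := by
        rw [← h3]; group
      rw [h4, map_mul, map_mul, map_mul, map_mul, map_inv, map_inv]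
    -- project to `C_n`: the left side dies, so `c d (u•c)⁻¹ = 1`
    have h5 : c * d * (affRot n u c)⁻¹ = 1 := by
      have h6 := congrArg π h1
      rw [map_mul, map_inv, hπaff, hπN ν'' hν''mem, map_one, inv_one, one_mul, hπη,
        SemidirectProduct.rightHom_inr] at h6
      exact h6.symm
    rw [coe_chiUnit, ← hu]
    have h7 : ν''⁻¹ * affHat n u 0 ν'' = 1 := by rw [h1, h5, map_one, map_one]
    rw [inv_mul_eq_one] at h7
    exact h7.symm
  -- (PBF) transported, then `ρ`
  have hν''cl := mem_closure_fixedLetters_of_PBF n hPBF (chiUnit p n '' U)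
    (by rw [← coe_NhatSub]; exact hν''mem) (by rintro _ ⟨σ, hσ, rfl⟩; exact hν''fix σ hσ)
  let ρ := rho n ψ hψ
  have hK : (Subgroup.closure (FreeGroup.of '' {i : ZMod n | ∀ u ∈ chiUnit p n '' U, (u : ZMod n) * i = i})).map
      (letterPart n ψ hψ) ≤ Subgroup.zpowers A := by
    rw [Subgroup.map_le_iff_le_comap, Subgroup.closure_le]
    rintro _ ⟨i, hi, rfl⟩
    have hi' : ∀ σ ∈ U, ZHatLevel.levelChar n (chi p σ) * i = i := fun σ hσ => hi (chiUnit p n σ) ⟨σ, hσ, rfl⟩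
    rw [SetLike.mem_coe, Subgroup.mem_comap, letterPart_of, hBpow i hi', one_mul, inv_one, mul_one, ← hA]
    exact Subgroup.mem_zpowers A
  have hρν'' : ρ ν'' ∈ Subgroup.zpowers A := by
    have himg : ρ ν'' ∈ closure (ρ '' (etaL n '' (SemidirectProduct.inl ''
        (Subgroup.closure (FreeGroup.of '' {i : ZMod n | ∀ u ∈ chiUnit p n '' U, (u : ZMod n) * i = i}) :
          Set (FreeGroup (ZMod n)))))) :=
      image_closure_subset_closure_image ρ.continuous ⟨ν'', hν''cl, rfl⟩
    have hcl : IsClosed ((Subgroup.zpowers A : Set ((ProfiniteGrp.ProfiniteCompletion.diagram (GrpCat.of F₂)).obj M))) :=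
      isClosed_discrete _
    refine (hcl.closure_subset_iff.2 ?_) himg
    rintro _ ⟨_, ⟨_, ⟨g, hg, rfl⟩, rfl⟩, rfl⟩
    change ρ (etaL n (SemidirectProduct.inl g)) ∈ Subgroup.zpowers A
    rw [show ρ (etaL n (SemidirectProduct.inl g)) = lamPart n ψ hψ (SemidirectProduct.inl g) from rho_etaL n ψ hψ _,
      lamPart, SemidirectProduct.lift_inl]
    exact hK ⟨g, hg, rfl⟩
  -- `ρ(η(inr c)) = B^l`
  have hρc : ∃ l : ℤ, ρ (etaL n (SemidirectProduct.inr c)) = B ^ l := by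
    haveI : NeZero (n : ℕ) := ⟨n.ne_zero⟩
    refine ⟨((Multiplicative.toAdd c).val : ℤ), ?_⟩
    rw [show ρ (etaL n (SemidirectProduct.inr c)) = lamPart n ψ hψ (SemidirectProduct.inr c) from rho_etaL n ψ hψ _,
      lamPart_inr, hB]
    have h := rotPart_ofAdd_intCast n ψ hψ ((Multiplicative.toAdd c).val : ℤ)
    rw [Int.cast_natCast, ZMod.natCast_zmod_val, ofAdd_toAdd] at h
    exact h
  -- conclusion at level `M`: `ψ x = A^k B^l = ψ(a^{ιk} b^{ιl})`
  obtain ⟨k, hk⟩ := Subgroup.mem_zpowers_iff.1 hρν''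
  obtain ⟨l, hl⟩ := hρc
  refine ⟨(iotaZ (Multiplicative.ofAdd k), iotaZ (Multiplicative.ofAdd l)), ?_⟩
  change levelMap M (x⁻¹ * F _) = 1
  rw [map_mul, map_inv, inv_mul_eq_one]
  change ψ x = ψ (powHat (eta (FreeGroup.of 0)) (iotaZ (Multiplicative.ofAdd k)) * bPow (iotaZ (Multiplicative.ofAdd l)))
  rw [map_mul, powHat_iotaZ, bPow_iotaZ, toAdd_ofAdd, toAdd_ofAdd, map_zpow, map_zpow, ← hA, ← hB,
    show ψ x = ρ q from (rho_phi n ψ hψ x).symm, hqdec, map_mul, ← hk, hl]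
end StableLines

end Literature.AnabelianGeometry.EtaleTheta.SettingModel.BTorsionTower

end
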